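/-
Copyright (c) 2026. All rights reserved.
Released under Apache 2.0 license as described in the file LICENSE.
-/
import Mathlib
import Summits.MatrixMultiplication.MatrixMultiplication.Theorems.SubgroupIdentityDesigns.Negative.WitnessNeumannCounts
import Summits.MatrixMultiplication.MatrixMultiplication.Theorems.SubgroupIdentityDesigns.Negative.LevelOneDimSqueeze

/-!
# The Neumann squeeze: no level-one witness for `ε ≤ ε_N(p) ≈ 1.22/(log p − 0.61)`, every dimension

Support file for the crux `LevelGradedCohnUmans.SubgroupIdentityDesigns` (the crux item stays
open; this is a NEGATIVE structural result about its level-one slice `k = 1`, uniform in the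
dimension `m = 1 + l`).

`LevelOneDimSqueeze` closed the level-one slice of every `GL_{1+l}(𝔽_p)` for
`0 < ε ≤ ε₃(p) = 2 log 2/(3 log p − log 2)` from the packing wall `2V² ≤ D³`.  The VOLUME LAW of a
witness (`WitnessNeumannCounts.crux_volume_law`, from the two graded Neumann counts)
`V ≤ u D − u³ + u²`, `u² ≤ D`, has the sharper closed-form ceiling

* `law_ceiling` : **`u D − u³ + u² ≤ 2 ((√D + 1/2)/√3)³ = (2/(3√3)) (√D + 1/2)³`**
  (`u² ≤ u √D`, `D + √D ≤ (√D + 1/2)²`, and AM–GM `u · 3w² − u³ ≤ 2 w³`, `cubic_am_gm`),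

i.e. the constant `2^{-1/2} ≈ 0.707` of the packing wall `V ≤ (D³/2)^{1/2}` drops to
`2/(3√3) ≈ 0.385`.  Feeding it through the exact level-one floor and the exact dimension bound
exactly as `LevelOneDimSqueeze` does:

* `levelOne_neumann_master` : a level-one witness at `ε` in `GL_{1+l}(𝔽_p)`, `l ≥ 1`, forces, with
  `s = 2 + ε`, `a = (p^{1+l} − p)/(p − 1)`, `b = (p^{1+l} − 1)/(p − 1)`, `D_m = 1 + a² + (p−2) b²`:
  **`1 + a^s + (p − 2) b^s < (2 ((√D_m + 1/2)/√3)³)^{s/3}`**;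
* `no_levelOne_witness_neumann_core` : if `D_m ≥ 1600` and **`p^{ε/2} ≤ (5/2)^{(2+ε)/3}`** then
  there is NO level-one witness in `GL_{1+l}(𝔽_p)` at `ε` (power mean
  `D_m^{s/2} ≤ p^{ε/2} (1 + a^s + (p−2) b^s)` and `5 (t + 1/2)³ ≤ 3√3 · t³` for `t = √D_m ≥ 40`);
* `no_levelOne_witness_neumann_eps` : the same under the arithmetic hypotheses `l ≥ 1`, `p ≥ 11`
  and (`p ≥ 13` or `l ≥ 2`) (which give `D_m ≥ 1600`, `dm_ge`).  (The cell `(m, p) = (2, 11)`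
  not covered is empty for all `0 < ε ≤ 1` by `CellTwoOneEmpty`; `p ≤ 7` by
  `LevelOneSmallPrimes`.)

The closed form of the threshold (`p³ ≤ (5/2)^{4q+2} ⇒` threshold for all `ε ≤ 1/q`; `p ≤ 19`
for `ε ≤ 1/2`, `p ≤ 241` for `ε ≤ 1/4`) and the packaging over all primes and dimensions are in
`Negative/LevelOneUniform.lean`.

The admissible window `ε_N(p)`: `p^{ε/2} ≤ (5/2)^{(2+ε)/3}` iff
`ε ≤ 2 log(5/2)/((3/2) log p − log(5/2)) ≈ 1.2217/(log p − 0.6109)`: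
`ε_N(11) ≈ 0.68`, `ε_N(13) ≈ 0.63`, `ε_N(19) ≈ 0.52`, `ε_N(101) ≈ 0.31`, `ε_N(241) ≈ 0.25`,
`ε_N(1009) ≈ 0.19` — about three times the window `ε₃(p)` of `LevelOneDimSqueeze`
(`ε₃(11) ≈ 0.20`, `ε₃(101) ≈ 0.10`, `ε₃(1009) ≈ 0.069`).  Together with
`LevelOneSmallPrimes` (`p ≤ 7`, all `0 < ε ≤ 1`) and `CellTwoOneEmpty` (`m = 2`, all `p`,
`0 < ε ≤ 1`): the level-one slice of the crux is EMPTY at every `(p, m)` for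
`0 < ε ≤ min(1, ε_N(p))`.

Honest framing: VALUE = THEOREM, NOT summit progress.  Sorry-free; standard axioms; no new
definitions.  Report: `run/shared/lean/b2b/levelgraded-cu/ORACLE-g19.md` §G19-4.
-/

set_option linter.dupNamespace false

noncomputable section

open scoped BigOperators Classical Matrix
open Module (finrank)

namespace Summit.MatrixMultiplication.MatrixMultiplication.Theorems.SubgroupIdentityDesigns.Negative
namespace LevelOneNeumannSqueeze

open Literature.Barriers.MatrixMultiplication (SubgroupTPP)
open Summit.MatrixMultiplication.MatrixMultiplication.Theorems.LieRankDesigns.Negative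
  (GLm Mat budget)
open Summit.MatrixMultiplication.MatrixMultiplication.Theorems.LevelOneGL2Designs.Negative
  (levelSubmodule)
open WitnessNeumannCounts (crux_volume_law)
open LevelOneExact (budget_ge_exact)
open LevelOneDim (finrank_levelOne_le_real)
open LevelOneDimSqueeze (pow_mean_three)

/-! ## The closed-form ceiling of the volume law -/

/-- AM–GM at the critical point: `u · 3w² − u³ ≤ 2 w³` for `u, w ≥ 0`
(`2w³ − 3w²u + u³ = (u − w)² (u + 2w)`). -/
theorem cubic_am_gm {u w : ℝ} (hu : 0 ≤ u) (hw : 0 ≤ w) :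
    u * (3 * w ^ 2) - u ^ 3 ≤ 2 * w ^ 3 := by
  nlinarith [mul_nonneg (sq_nonneg (u - w)) (by linarith : (0 : ℝ) ≤ u + 2 * w)]

/-- **THE LAW CEILING.**  `0 ≤ u`, `u² ≤ D` ⇒ `u D − u³ + u² ≤ 2 ((√D + 1/2)/√3)³`. -/
theorem law_ceiling {u D : ℝ} (hu : 0 ≤ u) (hD : 0 ≤ D) (huD : u ^ 2 ≤ D) :
    u * D - u ^ 3 + u ^ 2 ≤ 2 * ((Real.sqrt D + 1 / 2) / Real.sqrt 3) ^ 3 := by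
  set t : ℝ := Real.sqrt D with ht_def
  have htt : t ^ 2 = D := Real.sq_sqrt hD
  have hut : u ≤ t := by
    rw [ht_def, ← Real.sqrt_sq hu]
    exact Real.sqrt_le_sqrt huD
  have hs3 : (0 : ℝ) < Real.sqrt 3 := Real.sqrt_pos.2 (by norm_num)
  have h3 : Real.sqrt 3 ^ 2 = 3 := Real.sq_sqrt (by norm_num)
  have ht0 : 0 ≤ t := Real.sqrt_nonneg D
  set w : ℝ := (t + 1 / 2) / Real.sqrt 3 with hw_def
  have hw0 : 0 ≤ w := div_nonneg (by linarith) hs3.le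
  have h3w : 3 * w ^ 2 = (t + 1 / 2) ^ 2 := by
    rw [hw_def, div_pow, h3]; ring
  have key := cubic_am_gm hu hw0
  rw [h3w] at key
  have e : u * (t + 1 / 2) ^ 2 = u * D + u * t + u / 4 := by rw [← htt]; ring
  have huu : u * u ≤ u * t := mul_le_mul_of_nonneg_left hut hu
  nlinarith [key, e, huu]

/-- Monotonicity of the ceiling in `D`. -/
theorem ceiling_mono {D E : ℝ} (hDE : D ≤ E) :
    2 * ((Real.sqrt D + 1 / 2) / Real.sqrt 3) ^ 3 ≤
      2 * ((Real.sqrt E + 1 / 2) / Real.sqrt 3) ^ 3 := by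
  have hs3 : (0 : ℝ) < Real.sqrt 3 := Real.sqrt_pos.2 (by norm_num)
  have h1 : (Real.sqrt D + 1 / 2) / Real.sqrt 3 ≤ (Real.sqrt E + 1 / 2) / Real.sqrt 3 := by
    rw [div_le_div_iff_of_pos_right hs3]
    linarith [Real.sqrt_le_sqrt hDE]
  have h0 : 0 ≤ (Real.sqrt D + 1 / 2) / Real.sqrt 3 :=
    div_nonneg (by linarith [Real.sqrt_nonneg D]) hs3.le
  have := pow_le_pow_left₀ h0 h1 3
  linarith

/-! ## The master inequality -/

variable {p : ℕ} [hp : Fact p.Prime] {l : ℕ}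

/-- **THE NEUMANN MASTER INEQUALITY OF A LEVEL-ONE WITNESS.**  With `s = 2 + ε`,
`a = (p^{1+l} − p)/(p − 1)`, `b = (p^{1+l} − 1)/(p − 1)`, `D_m = 1 + a² + (p − 2) b²`:
`1 + a^s + (p − 2) b^s < (2 ((√D_m + 1/2)/√3)³)^{s/3}`. -/
theorem levelOne_neumann_master (hl : 1 ≤ l) {ε : ℝ} (hε : 0 < ε)
    {H₁ H₂ H₃ : Subgroup (GLm p (1 + l))} (htpp : SubgroupTPP H₁ H₂ H₃)
    (hdes : ∃ c : Mat p (1 + l) → ℂ, (∀ M, 1 < M.rank → c M = 0) ∧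
      (∑ M, c M * ZMod.stdAddChar (Matrix.trace (M * ((1 : GLm p (1 + l)) : Mat p (1 + l))))) = 1 ∧
      ∀ a ∈ H₁, ∀ b ∈ H₂, ∀ g ∈ H₃, a * b * g ≠ 1 →
        (∑ M, c M * ZMod.stdAddChar
          (Matrix.trace (M * ((a * b * g : GLm p (1 + l)) : Mat p (1 + l))))) = 0)
    (hlt : budget p (1 + l) 1 (2 + ε) <
      ((Nat.card H₁ * Nat.card H₂ * Nat.card H₃ : ℕ) : ℝ) ^ ((2 + ε) / 3)) :
    1 + (((p : ℝ) ^ (1 + l) - p) / ((p : ℝ) - 1)) ^ (2 + ε) +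
        ((p : ℝ) - 2) * (((p : ℝ) ^ (1 + l) - 1) / ((p : ℝ) - 1)) ^ (2 + ε) <
      (2 * ((Real.sqrt (1 + (((p : ℝ) ^ (1 + l) - p) / ((p : ℝ) - 1)) ^ 2 +
          ((p : ℝ) - 2) * (((p : ℝ) ^ (1 + l) - 1) / ((p : ℝ) - 1)) ^ 2) + 1 / 2) /
            Real.sqrt 3) ^ 3) ^ ((2 + ε) / 3) := by
  obtain ⟨u, hu1, -, -, -, h5, h6⟩ := crux_volume_law (k := 1) htpp hdes
  have hD := finrank_levelOne_le_real (p := p) (m := 1 + l) (by omega)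
  set s : ℝ := 2 + ε with hs_def
  have hs : 0 < s := by rw [hs_def]; linarith
  set V : ℕ := Nat.card H₁ * Nat.card H₂ * Nat.card H₃ with hV_def
  set D : ℕ := finrank ℂ (levelSubmodule p (1 + l) 1) with hD_def
  set D₂ : ℝ := 1 + (((p : ℝ) ^ (1 + l) - p) / ((p : ℝ) - 1)) ^ 2 +
      ((p : ℝ) - 2) * (((p : ℝ) ^ (1 + l) - 1) / ((p : ℝ) - 1)) ^ 2 with hD₂_def
  -- floor
  have hfl := (budget_ge_exact (p := p) hl s).trans_lt hlt
  -- the law in `ℝ`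
  have hV0 : (0 : ℝ) ≤ (V : ℝ) := Nat.cast_nonneg _
  have hD0 : (0 : ℝ) ≤ (D : ℝ) := Nat.cast_nonneg _
  have hu0 : (0 : ℝ) ≤ (u : ℝ) := Nat.cast_nonneg _
  have h5R : ((u : ℝ)) ^ 2 ≤ (D : ℝ) := by
    have h := (Nat.cast_le (α := ℝ)).mpr h5
    push_cast at h
    nlinarith [h]
  have h6R : (V : ℝ) ≤ (u : ℝ) * (D : ℝ) - (u : ℝ) ^ 3 + (u : ℝ) ^ 2 := by
    have h := (Nat.cast_le (α := ℝ)).mpr h6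
    push_cast [Nat.cast_sub hu1] at h
    nlinarith [h]
  have hVC : (V : ℝ) ≤ 2 * ((Real.sqrt D₂ + 1 / 2) / Real.sqrt 3) ^ 3 :=
    (h6R.trans (law_ceiling hu0 hD0 h5R)).trans (ceiling_mono hD)
  have hup : (V : ℝ) ^ (s / 3) ≤ (2 * ((Real.sqrt D₂ + 1 / 2) / Real.sqrt 3) ^ 3) ^ (s / 3) :=
    Real.rpow_le_rpow hV0 hVC (by positivity)
  exact hfl.trans_le hup

/-! ## The small-`ε` verdict -/

/-- The numerical heart: `(5/2) · 2 ((t + 1/2)/√3)³ ≤ t³` for `t ≥ 40`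
(`5 (t + 1/2)³ ≤ 1.732³ t³ ≤ (√3)³ t³`). -/
theorem ceiling_le_cube {t : ℝ} (ht : 40 ≤ t) :
    (5 / 2 : ℝ) * (2 * ((t + 1 / 2) / Real.sqrt 3) ^ 3) ≤ t ^ 3 := by
  have hs3 : (0 : ℝ) < Real.sqrt 3 := Real.sqrt_pos.2 (by norm_num)
  have h1732 : (1.732 : ℝ) ≤ Real.sqrt 3 := by
    rw [show (1.732 : ℝ) = Real.sqrt (1.732 ^ 2) from (Real.sqrt_sq (by norm_num)).symm]
    exact Real.sqrt_le_sqrt (by norm_num)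
  have hr : 0 ≤ t - 40 := by linarith
  have key : 5 * (t + 1 / 2) ^ 3 ≤ (1.732 : ℝ) ^ 3 * t ^ 3 := by
    nlinarith [mul_nonneg (mul_nonneg hr hr) hr, mul_nonneg hr hr, hr]
  have ht0 : 0 ≤ t := by linarith
  have hpow : (1.732 : ℝ) ^ 3 ≤ Real.sqrt 3 ^ 3 := pow_le_pow_left₀ (by norm_num) h1732 3
  have hpow' : (1.732 : ℝ) ^ 3 * t ^ 3 ≤ Real.sqrt 3 ^ 3 * t ^ 3 :=
    mul_le_mul_of_nonneg_right hpow (by positivity)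
  rw [div_pow, show (5 / 2 : ℝ) * (2 * ((t + 1 / 2) ^ 3 / Real.sqrt 3 ^ 3)) =
    5 * (t + 1 / 2) ^ 3 / Real.sqrt 3 ^ 3 by ring, div_le_iff₀ (by positivity)]
  calc 5 * (t + 1 / 2) ^ 3 ≤ (1.732 : ℝ) ^ 3 * t ^ 3 := key
    _ ≤ Real.sqrt 3 ^ 3 * t ^ 3 := hpow'
    _ = t ^ 3 * Real.sqrt 3 ^ 3 := mul_comm _ _

/-- **NO LEVEL-ONE WITNESS UNDER THE NEUMANN THRESHOLD (core form).**  If `D_m ≥ 1600` and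
`p^{ε/2} ≤ (5/2)^{(2+ε)/3}` then no subgroup triple of `GL_{1+l}(𝔽_p)`, `l ≥ 1`, carrying a
level-one identity design satisfies the crux inequality at `ε`. -/
theorem no_levelOne_witness_neumann_core (hl : 1 ≤ l) {ε : ℝ} (hε : 0 < ε)
    (hDm : (1600 : ℝ) ≤ 1 + (((p : ℝ) ^ (1 + l) - p) / ((p : ℝ) - 1)) ^ 2 +
      ((p : ℝ) - 2) * (((p : ℝ) ^ (1 + l) - 1) / ((p : ℝ) - 1)) ^ 2)
    (hthr : (p : ℝ) ^ (ε / 2) ≤ (5 / 2 : ℝ) ^ ((2 + ε) / 3))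
    {H₁ H₂ H₃ : Subgroup (GLm p (1 + l))} (htpp : SubgroupTPP H₁ H₂ H₃)
    (hdes : ∃ c : Mat p (1 + l) → ℂ, (∀ M, 1 < M.rank → c M = 0) ∧
      (∑ M, c M * ZMod.stdAddChar (Matrix.trace (M * ((1 : GLm p (1 + l)) : Mat p (1 + l))))) = 1 ∧
      ∀ a ∈ H₁, ∀ b ∈ H₂, ∀ g ∈ H₃, a * b * g ≠ 1 →
        (∑ M, c M * ZMod.stdAddChar
          (Matrix.trace (M * ((a * b * g : GLm p (1 + l)) : Mat p (1 + l))))) = 0) :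
    ¬ budget p (1 + l) 1 (2 + ε) <
      ((Nat.card H₁ * Nat.card H₂ * Nat.card H₃ : ℕ) : ℝ) ^ ((2 + ε) / 3) := by
  intro hlt
  have hm := levelOne_neumann_master hl hε htpp hdes hlt
  have hp2 : 2 ≤ p := hp.out.two_le
  have hpR : (2 : ℝ) ≤ p := by exact_mod_cast hp2
  have hp0 : (0 : ℝ) < p := by linarith
  have hp1 : (0 : ℝ) < (p : ℝ) - 1 := by linarith
  have hPp : (p : ℝ) ≤ (p : ℝ) ^ (1 + l) := by
    calc (p : ℝ) = (p : ℝ) ^ 1 := (pow_one _).symm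
      _ ≤ (p : ℝ) ^ (1 + l) := pow_le_pow_right₀ (by linarith) (by omega)
  set a : ℝ := ((p : ℝ) ^ (1 + l) - p) / ((p : ℝ) - 1) with ha_def
  set b : ℝ := ((p : ℝ) ^ (1 + l) - 1) / ((p : ℝ) - 1) with hb_def
  have ha0 : 0 ≤ a := div_nonneg (by linarith) hp1.le
  have hb0 : 0 ≤ b := div_nonneg (by linarith) hp1.le
  set s : ℝ := 2 + ε with hs_def
  have hs : 0 < s := by rw [hs_def]; linarith
  set Dm : ℝ := 1 + a ^ 2 + ((p : ℝ) - 2) * b ^ 2 with hDm_def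
  set Fl : ℝ := 1 + a ^ s + ((p : ℝ) - 2) * b ^ s with hFl_def
  set C : ℝ := 2 * ((Real.sqrt Dm + 1 / 2) / Real.sqrt 3) ^ 3 with hC_def
  -- power mean: `Dm^{s/2} ≤ p^{ε/2} Fl`
  have hq : 1 ≤ s / 2 := by rw [hs_def]; linarith
  have hpm := pow_mean_three (P₀ := (p : ℝ)) (A := a ^ 2) (B := b ^ 2) hpR (by positivity)
    (by positivity) hq
  have ea : (a ^ 2) ^ (s / 2) = a ^ s := by
    rw [← Real.rpow_natCast a 2, ← Real.rpow_mul ha0]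
    congr 1; push_cast; ring
  have eb : (b ^ 2) ^ (s / 2) = b ^ s := by
    rw [← Real.rpow_natCast b 2, ← Real.rpow_mul hb0]
    congr 1; push_cast; ring
  have es : s / 2 - 1 = ε / 2 := by rw [hs_def]; ring
  rw [ea, eb, es] at hpm
  -- `hpm : Dm ^ (s/2) ≤ p ^ (ε/2) * Fl`, `hm : Fl < C ^ (s/3)`
  have hDm0 : 0 ≤ Dm := by linarith
  have hs30 : (0 : ℝ) < Real.sqrt 3 := Real.sqrt_pos.2 (by norm_num)
  have hC0 : 0 ≤ C := by
    rw [hC_def]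
    have : 0 ≤ (Real.sqrt Dm + 1 / 2) / Real.sqrt 3 :=
      div_nonneg (by linarith [Real.sqrt_nonneg Dm]) hs30.le
    positivity
  have hpe : 0 < (p : ℝ) ^ (ε / 2) := Real.rpow_pos_of_pos hp0 _
  have hchain : Dm ^ (s / 2) < ((5 / 2 : ℝ) * C) ^ (s / 3) := by
    calc Dm ^ (s / 2) ≤ (p : ℝ) ^ (ε / 2) * Fl := hpm
      _ < (p : ℝ) ^ (ε / 2) * C ^ (s / 3) := mul_lt_mul_of_pos_left hm hpe
      _ ≤ (5 / 2 : ℝ) ^ (s / 3) * C ^ (s / 3) :=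
          mul_le_mul_of_nonneg_right hthr (Real.rpow_nonneg hC0 _)
      _ = ((5 / 2 : ℝ) * C) ^ (s / 3) := (Real.mul_rpow (by norm_num) hC0).symm
  -- `Dm ^ (s/2) = ((√Dm)³) ^ (s/3)`
  set t : ℝ := Real.sqrt Dm with ht_def
  have ht0 : 0 ≤ t := Real.sqrt_nonneg Dm
  have htt : t ^ 2 = Dm := Real.sq_sqrt hDm0
  have eD : Dm ^ (s / 2) = (t ^ 3) ^ (s / 3) := by
    rw [← htt, ← Real.rpow_natCast t 2, ← Real.rpow_natCast t 3, ← Real.rpow_mul ht0,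
      ← Real.rpow_mul ht0]
    congr 1; push_cast; ring
  rw [eD] at hchain
  -- so `t³ < (5/2) C`, contradicting `ceiling_le_cube`
  have ht40 : 40 ≤ t := by
    rw [ht_def, show (40 : ℝ) = Real.sqrt (40 ^ 2) from (Real.sqrt_sq (by norm_num)).symm]
    exact Real.sqrt_le_sqrt (by linarith)
  have hle : (5 / 2 : ℝ) * C ≤ t ^ 3 := ceiling_le_cube ht40
  have hge : ((5 / 2 : ℝ) * C) ^ (s / 3) ≤ (t ^ 3) ^ (s / 3) :=
    Real.rpow_le_rpow (by positivity) hle (by positivity)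
  exact absurd hchain (not_lt.mpr hge)

omit hp in
/-- `D_m ≥ 1600` from `l ≥ 1`, `p ≥ 11` and (`p ≥ 13` or `l ≥ 2`). -/
theorem dm_ge (hl : 1 ≤ l) (hp11 : 11 ≤ p) (hbig : 13 ≤ p ∨ 2 ≤ l) :
    (1600 : ℝ) ≤ 1 + (((p : ℝ) ^ (1 + l) - p) / ((p : ℝ) - 1)) ^ 2 +
      ((p : ℝ) - 2) * (((p : ℝ) ^ (1 + l) - 1) / ((p : ℝ) - 1)) ^ 2 := by
  have hpR : (11 : ℝ) ≤ p := by exact_mod_cast hp11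
  have hp1 : (0 : ℝ) < (p : ℝ) - 1 := by linarith
  set P : ℝ := (p : ℝ) ^ (1 + l) with hP_def
  set b : ℝ := (P - 1) / ((p : ℝ) - 1) with hb_def
  have hsq : 0 ≤ ((P - p) / ((p : ℝ) - 1)) ^ 2 := sq_nonneg _
  have hbP : b * ((p : ℝ) - 1) = P - 1 := div_mul_cancel₀ _ hp1.ne'
  rcases hbig with h13 | h2
  · -- `b ≥ p + 1 ≥ 14`, `(p − 2) b² ≥ 11 · 196`
    have h13R : (13 : ℝ) ≤ p := by exact_mod_cast h13
    have hP2 : (p : ℝ) ^ 2 ≤ P := by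
      rw [hP_def]; exact pow_le_pow_right₀ (by linarith) (by omega)
    have hb : (p : ℝ) + 1 ≤ b := by
      refine le_of_mul_le_mul_right ?_ hp1
      rw [hbP]; nlinarith
    have hb14 : (14 : ℝ) ≤ b := by linarith
    have hb2 : (14 : ℝ) ^ 2 ≤ b ^ 2 := pow_le_pow_left₀ (by norm_num) hb14 2
    have : (11 : ℝ) * 14 ^ 2 ≤ ((p : ℝ) - 2) * b ^ 2 :=
      mul_le_mul (by linarith) hb2 (by norm_num) (by linarith)
    nlinarith
  · -- `b ≥ p² + p + 1 ≥ 133`, `(p − 2) b² ≥ 9 · 133²`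
    have hP3 : (p : ℝ) ^ 3 ≤ P := by
      rw [hP_def]; exact pow_le_pow_right₀ (by linarith) (by omega)
    have hb : (p : ℝ) ^ 2 + p + 1 ≤ b := by
      refine le_of_mul_le_mul_right ?_ hp1
      rw [hbP]; nlinarith
    have hb133 : (133 : ℝ) ≤ b := by nlinarith
    have hb2 : (133 : ℝ) ^ 2 ≤ b ^ 2 := pow_le_pow_left₀ (by norm_num) hb133 2
    have : (9 : ℝ) * 133 ^ 2 ≤ ((p : ℝ) - 2) * b ^ 2 :=
      mul_le_mul (by linarith) hb2 (by norm_num) (by linarith)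
    nlinarith

/-- **NO LEVEL-ONE WITNESS FOR `ε ≤ ε_N(p)`, EVERY DIMENSION `≥ 3` (and `≥ 2` for `p ≥ 13`).**
If `p ≥ 11`, `l ≥ 1`, (`p ≥ 13` or `l ≥ 2`) and `p^{ε/2} ≤ (5/2)^{(2+ε)/3}` then no subgroup
triple of `GL_{1+l}(𝔽_p)` carrying a level-one identity design satisfies the crux inequality
at `ε`. -/
theorem no_levelOne_witness_neumann_eps (hl : 1 ≤ l) (hp11 : 11 ≤ p) (hbig : 13 ≤ p ∨ 2 ≤ l)
    {ε : ℝ} (hε : 0 < ε) (hthr : (p : ℝ) ^ (ε / 2) ≤ (5 / 2 : ℝ) ^ ((2 + ε) / 3))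
    {H₁ H₂ H₃ : Subgroup (GLm p (1 + l))} (htpp : SubgroupTPP H₁ H₂ H₃)
    (hdes : ∃ c : Mat p (1 + l) → ℂ, (∀ M, 1 < M.rank → c M = 0) ∧
      (∑ M, c M * ZMod.stdAddChar (Matrix.trace (M * ((1 : GLm p (1 + l)) : Mat p (1 + l))))) = 1 ∧
      ∀ a ∈ H₁, ∀ b ∈ H₂, ∀ g ∈ H₃, a * b * g ≠ 1 →
        (∑ M, c M * ZMod.stdAddChar
          (Matrix.trace (M * ((a * b * g : GLm p (1 + l)) : Mat p (1 + l))))) = 0) :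
    ¬ budget p (1 + l) 1 (2 + ε) <
      ((Nat.card H₁ * Nat.card H₂ * Nat.card H₃ : ℕ) : ℝ) ^ ((2 + ε) / 3) :=
  no_levelOne_witness_neumann_core hl hε (dm_ge hl hp11 hbig) hthr htpp hdes

end LevelOneNeumannSqueeze
end Summit.MatrixMultiplication.MatrixMultiplication.Theorems.SubgroupIdentityDesigns.Negative
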